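import Summits.ABC.ABC.Theorems.TowerFourSubLiouville.Negative.TwoExponentSandwichSharp

/-!
# `TowerFourSubLiouville` (stmt-ABC-1649): the axis boundary point `(θ, φ) = (2, 0)` of the two-exponent diagram is FALSE —
value-`1` enemies at coefficient height `≤ (2/3)·Z²`

Negative-side module of the standing disprover (cycle 15, refuter-cdisprove-stmt-ABC-1649-g15-0, 2026-08-17), companion of
`Negative.TorusBezoutCorner` (p138228: the Pell–Bezout family `(16Z²+12)Z⁴ − (4Z²−1)Y⁴ = 1`, `Y² = 2Z² + 1`, height `≤ 28Z²`, hence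
`¬ UBQ₂(θ, φ)` for `θ > 2`, `φ ≥ 0`) and `Negative.TwoExponentSandwichSharp` (p143568: `ABC ⟹ UBQ₂(θ, φ)` on `θ + φ < 2`;
`ubq₂_axis_iff_of_abc : UBQ₂(θ, 0) ↔ θ < 2` for `θ ≠ 2`).  The typed matrix `UBQ₂(θ, φ)` carries the constant `1`
(`max(v, w) ≤ Z^θ`), so the boundary point `θ = 2` of the axis was left undecided by the constant `16` of Pell–Bezout.

THE `d = 3` TWIST OF BEZOUT.  The polynomial identity `(2u² + 1)(u² − 1)² − (2u² − 3)u⁴ = 1` (`bezout_sq_identity`) becomes a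
binomial-quartic enemy whenever `u² − 1 = d·s²`; Pell–Bezout is `d = 2`.  For `d = 3` (`u² = 3s² + 1`, Mathlib's `a = 2` Pell) one has
`2u² + 1 = 3(2s² + 1)` and, when `3 ∤ s`, `3 ∣ 2s² + 1`: so `3⁴ ∣ (2u² + 1)·d² = 27(2s² + 1)` and the fourth power `3⁴` moves into `Z`:

  `w·(3s)⁴ − (6s² − 1)·u⁴ = 1`,  `w = (2s² + 1)/3`,  i.e.  `(v, w, Y, Z) = (6s² − 1, (2s²+1)/3, u, 3s)`,  `v = (2/3)Z² − 1`, `w < v`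

(`pell3Bezout_identity`; members `1·3⁴ − 5·2⁴ = 1`, `11·12⁴ − 95·7⁴ = 1`, `2091·168⁴ − 18815·97⁴ = 1`, …; `3 ∤ s` holds at Pell
indices `m ≢ 0 (mod 3)`, realised here by the three-step recursion `(u, s) ↦ (26u + 45s, 15u + 26s)`, which maps `s ↦ −s (mod 3)`).
A coprime value-`1` family at height `max(v, w) ≤ (2/3)Z² < Z²`, beyond every bound (`exists_pell3Bezout`).  Consequences
(matrices verbatim from `Negative.TwoExponentDiagram` / `TwoExponentSandwichSharp` / `TorusBezoutCorner`):
* `not_ubq₂_of_two_le`: **`UBQ₂(θ, φ)` is FALSE for every `θ ≥ 2`, `φ ≥ 0`** — the lobe `{θ > 2, φ ≥ 0}` of p138228 is CLOSED: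
  `{θ ≥ 2, φ ≥ 0}`; in particular `not_ubq₂_two_zero`: the axis point `(2, 0)` itself is false;
* `ubq₂_axis_iff_of_abc'`: **under `ABC`, `UBQ₂(θ, 0) ⟺ θ < 2` for EVERY `θ ≥ 0`** (p143568 needed `θ ≠ 2`): the axis is decided;
* `not_ubq₃_of_two_two_zero_le`: the three-exponent matrix of `ubq₃_of_abc` is false at and beyond the corner `(θ_v, θ_w, φ) = (2, 2, 0)`
  (ON the torus Mason–Stothers plane `(3/4)θ_v + (1/4)θ_w + φ = 2`, where `ABC` says nothing);
* ladder and slices at the pin: `movingThue4_budget_lt_two` (Thue rung: at `ε ≤ 1` no budget `η ≥ 2`; was `> 2`),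
  `movingRoth4_budget_lt_two` (Roth rung: at `ε ≤ 2` no budget `η ≥ 2`), `not_ubqOn_unitSlice_of_two_le` (Dc1/S⁺7: `η ≥ 2` false; was `> 2`);
* `ubq₂_false_of_corner₇`: the proved FALSE region is `{θ ≥ 2, φ ≥ 0} ∪ {θ > 1, φ > 3/2} ∪ {θ > 0, φ > 2}`.
What stays open on the axis is only the CONSTANT: value `1` occurs at height `(2/3)Z²` (here); whether it occurs at height `≤ cZ²` for
every `c > 0` is the `q`-adic accumulation question of the disprover's notes (Disproof.lean § (15b)) — sub-polynomial, invisible to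
`UBQ₂`.  Calibration, not a kill: the crux needs a diagonal point `(η, η)`, `η > 0`.
-/

-- `Summit.ABC.ABC` is the mandated summit-side namespace (CONVENTIONS §2); the duplicate is deliberate.
set_option linter.dupNamespace false

namespace Summit.ABC.ABC.Theorems.TowerFourSubLiouville.Negative

/-! ## The `d = 3` Bezout family -/

/-- **Bezout for `u⁴` and `(u² − 1)²`, boosted by Pell `d = 3`, with `3⁴` absorbed into `Z`**:
`u² = 3s² + 1 ∧ 3w = 2s² + 1 ⟹ w·(3s)⁴ = (6s² − 1)·u⁴ + 1`. -/
theorem pell3Bezout_identity {u s w : ℕ} (h : u ^ 2 = 3 * s ^ 2 + 1) (hw : 3 * w = 2 * s ^ 2 + 1) :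
    w * (3 * s) ^ 4 = (6 * s ^ 2 - 1) * u ^ 4 + 1 := by
  have hs : 1 ≤ s := by
    rcases Nat.eq_zero_or_pos s with h0 | h0
    · subst h0; omega
    · exact h0
  have h1 : 1 ≤ 6 * s ^ 2 := by nlinarith
  zify [h1]
  have hz : ((u : ℤ)) ^ 2 = 3 * (s : ℤ) ^ 2 + 1 := by exact_mod_cast h
  have hwz : 3 * (w : ℤ) = 2 * (s : ℤ) ^ 2 + 1 := by exact_mod_cast hw
  linear_combination (27 * (s : ℤ) ^ 4) * hwz - ((6 * (s : ℤ) ^ 2 - 1) * ((u : ℤ) ^ 2 + 3 * (s : ℤ) ^ 2 + 1)) * hz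

/-- Three steps of the Pell recursion for `u² − 3s² = 1` at once: `(u, s) ↦ (26u + 45s, 15u + 26s)` (the unit `(2 + √3)³ = 26 + 15√3`);
it maps `s ↦ −s (mod 3)`, so it preserves `3 ∤ s`. -/
theorem pell3_step3 {u s : ℕ} (h : u ^ 2 = 3 * s ^ 2 + 1) :
    (26 * u + 45 * s) ^ 2 = 3 * (15 * u + 26 * s) ^ 2 + 1 := by
  have hz : ((u : ℤ)) ^ 2 = 3 * (s : ℤ) ^ 2 + 1 := by exact_mod_cast h
  have : ((26 * u + 45 * s : ℕ) : ℤ) ^ 2 = 3 * ((15 * u + 26 * s : ℕ) : ℤ) ^ 2 + 1 := by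
    push_cast
    linear_combination hz
  exact_mod_cast this

/-- Pell solutions `u² = 3s² + 1` with `3 ∤ s` and `s` beyond any bound (start `(2, 1)`, step `pell3_step3`). -/
theorem pell3_exists_ge_not_three_dvd (N : ℕ) :
    ∃ u s : ℕ, u ^ 2 = 3 * s ^ 2 + 1 ∧ N ≤ s ∧ (s % 3 = 1 ∨ s % 3 = 2) := by
  induction N with
  | zero => exact ⟨2, 1, by norm_num, Nat.zero_le _, Or.inl rfl⟩
  | succ n ih =>
    obtain ⟨u, s, h, hns, hs3⟩ := ih
    have hu : 1 ≤ u := by nlinarith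
    refine ⟨26 * u + 45 * s, 15 * u + 26 * s, pell3_step3 h, by omega, ?_⟩
    rcases hs3 with h1 | h2
    · right; omega
    · left; omega

/-- **The family packaged**: beyond every bound a coprime quadruple with `wZ⁴ = vY⁴ + 1` at height `max(v, w) = v = (2/3)Z² − 1 < Z²`
(`Z = 3s`, `v = 6s² − 1`, `w = (2s²+1)/3`, `Y = u`; coprimality `gcd(vY, wZ) = 1` is forced by the value `1`). -/
theorem exists_pell3Bezout (N : ℕ) : ∃ v w Y Z : ℕ, N ≤ Z ∧ 0 < v ∧ 0 < w ∧ 0 < Y ∧ 1 ≤ Z ∧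
    Nat.Coprime (v * Y) (w * Z) ∧ w * Z ^ 4 = v * Y ^ 4 + 1 ∧ w ≤ v ∧ v + 1 ≤ Z ^ 2 ∧ 2 * Z ^ 2 = 3 * (v + 1) := by
  obtain ⟨u, s, h, hNs, hs3⟩ := pell3_exists_ge_not_three_dvd (max N 1)
  have hs1 : 1 ≤ s := le_trans (le_max_right _ _) hNs
  have hNs' : N ≤ s := le_trans (le_max_left _ _) hNs
  have hu : 0 < u := by
    rcases Nat.eq_zero_or_pos u with h0 | h0
    · subst h0; simp at h
    · exact h0
  -- `3 ∣ 2s² + 1`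
  obtain ⟨w, hw⟩ : 3 ∣ 2 * s ^ 2 + 1 := by
    have hsq : s ^ 2 % 3 = 1 := by
      rw [Nat.pow_mod]
      rcases hs3 with h1 | h2
      · rw [h1]
      · rw [h2]
    omega
  have hw' : 3 * w = 2 * s ^ 2 + 1 := hw.symm
  have hid := pell3Bezout_identity h hw'
  have hw0 : 0 < w := by omega
  have hv6 : 1 ≤ 6 * s ^ 2 := by nlinarith
  refine ⟨6 * s ^ 2 - 1, w, u, 3 * s, by omega, by omega, hw0, hu, by omega, ?_, hid, ?_, ?_, ?_⟩
  · exact coprime_of_int_combination (a := -((u : ℤ) ^ 3)) (b := ((3 * s : ℕ) : ℤ) ^ 3) (r := 1)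
      (by
        have hid' : ((w * (3 * s) ^ 4 : ℕ) : ℤ) = (((6 * s ^ 2 - 1) * u ^ 4 + 1 : ℕ) : ℤ) := by
          exact_mod_cast hid
        push_cast at hid' ⊢
        linear_combination hid')
      (Nat.coprime_one_left _)
  · -- `w ≤ v`: `3w = 2s² + 1 ≤ 3(6s² − 1)`
    have : 3 * w ≤ 3 * (6 * s ^ 2 - 1) := by omega
    omega
  · -- `v + 1 = 6s² ≤ 9s² = Z²`
    have : (3 * s) ^ 2 = 9 * s ^ 2 := by ring
    omega
  · have : (3 * s) ^ 2 = 9 * s ^ 2 := by ring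
    omega

/-- The three smallest members: `1·3⁴ − 5·2⁴ = 1`, `11·12⁴ − 95·7⁴ = 1`, `2091·168⁴ − 18815·97⁴ = 1` (`s = 1, 4, 56`). -/
example : (1 : ℕ) * 3 ^ 4 = 5 * 2 ^ 4 + 1 ∧ (11 : ℕ) * 12 ^ 4 = 95 * 7 ^ 4 + 1 ∧
    (2091 : ℕ) * 168 ^ 4 = 18815 * 97 ^ 4 + 1 := by norm_num

/-! ## The closed lobe `{θ ≥ 2, φ ≥ 0}` -/

/-- **`UBQ₂(θ, φ)` fails for every `θ ≥ 2` and every `φ ≥ 0`** — the value of a coprime binomial quartic form is exactly `1` at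
coefficient height `≤ (2/3)Z² ≤ Z^θ` infinitely often (closes the lobe `{θ > 2, φ ≥ 0}` of `not_ubq₂_corner_two_zero`, p138228). -/
theorem not_ubq₂_of_two_le (θ φ : ℝ) (hθ : 2 ≤ θ) (hφ : 0 ≤ φ) :
    ¬ ∃ Z₀ : ℕ, ∀ v w Y Z : ℕ, Z₀ ≤ Z → 0 < v → 0 < w → 0 < Y → Nat.Coprime (v * Y) (w * Z) →
      ((max v w : ℕ) : ℝ) ≤ (Z : ℝ) ^ θ → w * Z ^ 4 ≠ v * Y ^ 4 →
      (Z : ℝ) ^ φ < |((w * Z ^ 4 : ℕ) : ℝ) - ((v * Y ^ 4 : ℕ) : ℝ)| := by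
  rintro ⟨Z₀, h⟩
  obtain ⟨v, w, Y, Z, hNZ, hv, hw, hY, hZ1, hcop, hid, hwv, hvZ, -⟩ := exists_pell3Bezout Z₀
  have hZR : (1 : ℝ) ≤ Z := by exact_mod_cast hZ1
  have hmax : ((max v w : ℕ) : ℝ) ≤ (Z : ℝ) ^ θ := by
    rw [max_eq_left hwv]
    have h1 : (v : ℝ) ≤ (Z : ℝ) ^ (2 : ℕ) := by
      have : ((v : ℕ) : ℝ) ≤ ((Z ^ 2 : ℕ) : ℝ) := by exact_mod_cast (Nat.le_of_succ_le hvZ)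
      push_cast at this; exact this
    have h2 : (Z : ℝ) ^ (2 : ℕ) ≤ (Z : ℝ) ^ θ := by
      rw [← Real.rpow_natCast]
      exact Real.rpow_le_rpow_of_exponent_le hZR (by exact_mod_cast hθ)
    exact h1.trans h2
  have hne : w * Z ^ 4 ≠ v * Y ^ 4 := by rw [hid]; omega
  have key := h v w Y Z hNZ hv hw hY hcop hmax hne
  have habs : |((w * Z ^ 4 : ℕ) : ℝ) - ((v * Y ^ 4 : ℕ) : ℝ)| = 1 := by
    rw [hid]; push_cast
    rw [show (((v : ℝ) * (Y : ℝ) ^ 4 + 1) - (v : ℝ) * (Y : ℝ) ^ 4) = 1 by ring]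
    norm_num
  rw [habs] at key
  have : (1 : ℝ) ≤ (Z : ℝ) ^ φ := Real.one_le_rpow hZR hφ
  linarith

/-- **The axis boundary point `(2, 0)` is false** (the one value of `θ` that `ubq₂_axis_iff_of_abc`, p143568, had to exclude). -/
theorem not_ubq₂_two_zero :
    ¬ ∃ Z₀ : ℕ, ∀ v w Y Z : ℕ, Z₀ ≤ Z → 0 < v → 0 < w → 0 < Y → Nat.Coprime (v * Y) (w * Z) →
      ((max v w : ℕ) : ℝ) ≤ (Z : ℝ) ^ (2:ℝ) → w * Z ^ 4 ≠ v * Y ^ 4 →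
      (Z : ℝ) ^ (0:ℝ) < |((w * Z ^ 4 : ℕ) : ℝ) - ((v * Y ^ 4 : ℕ) : ℝ)| :=
  not_ubq₂_of_two_le 2 0 le_rfl le_rfl

/-- **The axis `φ = 0` DECIDED under `ABC`: `UBQ₂(θ, 0) ⟺ θ < 2` for every `θ ≥ 0`** (no exception at `θ = 2`). -/
theorem ubq₂_axis_iff_of_abc' (habc : ABC) {θ : ℝ} (hθ0 : 0 ≤ θ) :
    (∃ Z₀ : ℕ, ∀ v w Y Z : ℕ, Z₀ ≤ Z → 0 < v → 0 < w → 0 < Y → Nat.Coprime (v * Y) (w * Z) →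
      ((max v w : ℕ) : ℝ) ≤ (Z : ℝ) ^ θ → w * Z ^ 4 ≠ v * Y ^ 4 →
      (Z : ℝ) ^ (0:ℝ) < |((w * Z ^ 4 : ℕ) : ℝ) - ((v * Y ^ 4 : ℕ) : ℝ)|) ↔ θ < 2 := by
  constructor
  · intro h
    by_contra hge
    push Not at hge
    exact not_ubq₂_of_two_le θ 0 hge le_rfl h
  · intro hθ
    exact ubq₂_of_abc_sharp habc hθ0 (by linarith)

/-- Unconditionally: a TRUE point of the axis has `θ < 2`. -/
theorem lt_two_of_ubq₂_axis {θ : ℝ}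
    (h : ∃ Z₀ : ℕ, ∀ v w Y Z : ℕ, Z₀ ≤ Z → 0 < v → 0 < w → 0 < Y → Nat.Coprime (v * Y) (w * Z) →
      ((max v w : ℕ) : ℝ) ≤ (Z : ℝ) ^ θ → w * Z ^ 4 ≠ v * Y ^ 4 →
      (Z : ℝ) ^ (0:ℝ) < |((w * Z ^ 4 : ℕ) : ℝ) - ((v * Y ^ 4 : ℕ) : ℝ)|) : θ < 2 := by
  by_contra hge
  push Not at hge
  exact not_ubq₂_of_two_le θ 0 hge le_rfl h

/-- **The proved FALSE region after cycle 15**: `{θ ≥ 2, φ ≥ 0} ∪ {θ > 1, φ > 3/2} ∪ {θ > 0, φ > 2}` (first lobe now CLOSED). -/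
theorem ubq₂_false_of_corner₇ {θ φ : ℝ}
    (hc : (2 ≤ θ ∧ 0 ≤ φ) ∨ (1 < θ ∧ 3 / 2 < φ) ∨ (0 < θ ∧ 2 < φ)) :
    ¬ ∃ Z₀ : ℕ, ∀ v w Y Z : ℕ, Z₀ ≤ Z → 0 < v → 0 < w → 0 < Y → Nat.Coprime (v * Y) (w * Z) →
      ((max v w : ℕ) : ℝ) ≤ (Z : ℝ) ^ θ → w * Z ^ 4 ≠ v * Y ^ 4 →
      (Z : ℝ) ^ φ < |((w * Z ^ 4 : ℕ) : ℝ) - ((v * Y ^ 4 : ℕ) : ℝ)| := by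
  rcases hc with ⟨hθ, hφ⟩ | ⟨hθ, hφ⟩ | ⟨hθ, hφ⟩
  · exact not_ubq₂_of_two_le θ φ hθ hφ
  · exact not_ubq₂_corner_one_threeHalves θ φ hθ hφ
  · exact not_ubq₂_corner_zero_two θ φ hθ hφ

/-- **The three-exponent corner `(2, 2, 0)` is false** (and everything beyond it): the matrix of `ubq₃_of_abc` (p143568) fails for
`θ_v ≥ 2`, `θ_w ≥ 2`, `φ ≥ 0` — a point ON the torus Mason–Stothers plane `(3/4)θ_v + (1/4)θ_w + φ = 2`. -/
theorem not_ubq₃_of_two_two_zero_le (θv θw φ : ℝ) (hθv : 2 ≤ θv) (hθw : 2 ≤ θw) (hφ : 0 ≤ φ) :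
    ¬ ∃ Z₀ : ℕ, ∀ v w Y Z : ℕ, Z₀ ≤ Z → 0 < v → 0 < w → 0 < Y → Nat.Coprime (v * Y) (w * Z) →
      (v : ℝ) ≤ (Z : ℝ) ^ θv → (w : ℝ) ≤ (Z : ℝ) ^ θw → w * Z ^ 4 ≠ v * Y ^ 4 →
      (Z : ℝ) ^ φ < |((w * Z ^ 4 : ℕ) : ℝ) - ((v * Y ^ 4 : ℕ) : ℝ)| := by
  rintro ⟨Z₀, h⟩
  refine not_ubq₂_of_two_le 2 φ le_rfl hφ ⟨max Z₀ 1, fun v w Y Z hZ hv hw hY hcop hmax hne => ?_⟩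
  have hZ1 : (1 : ℝ) ≤ Z := by exact_mod_cast le_trans (le_max_right Z₀ 1) hZ
  replace hZ : Z₀ ≤ Z := le_trans (le_max_left Z₀ 1) hZ
  have hv' : (v : ℝ) ≤ (Z : ℝ) ^ θv :=
    le_trans (le_trans (by exact_mod_cast le_max_left v w) hmax) (Real.rpow_le_rpow_of_exponent_le hZ1 hθv)
  have hw' : (w : ℝ) ≤ (Z : ℝ) ^ θw :=
    le_trans (le_trans (by exact_mod_cast le_max_right v w) hmax) (Real.rpow_le_rpow_of_exponent_le hZ1 hθw)
  exact h v w Y Z hZ hv hw hY hcop hv' hw' hne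

/-! ## Ladder and slices at the pin -/

/-- Thue rung of the moving-target ladder (`StrategistSketch.UniformMovingThue4`, matrix verbatim): at any `ε ≤ 1` no budget
`η ≥ 2` is possible (`movingThue4_budget_le_two`, p138228, had `η > 2`; `ABC` gives every `η < 1 + ε`, p143568). -/
theorem movingThue4_budget_lt_two {ε η : ℝ} (hε : ε ≤ 1) (hη : 2 ≤ η) :
    ¬ ∃ Z₀ : ℕ, ∀ v w Y Z : ℕ, Z₀ ≤ Z → 0 < v → 0 < w → 0 < Y → Nat.Coprime (v * Y) (w * Z) →
      ((max v w : ℕ) : ℝ) ≤ (Z : ℝ) ^ η → w * Z ^ 4 ≠ v * Y ^ 4 →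
      (Z : ℝ) ^ (1 - ε) < |((w * Z ^ 4 : ℕ) : ℝ) - ((v * Y ^ 4 : ℕ) : ℝ)| :=
  not_ubq₂_of_two_le η (1 - ε) hη (by linarith)

/-- Roth rung (`StrategistSketch.UniformMovingRoth4`, matrix verbatim): at any `ε ≤ 2` no budget `η ≥ 2` is possible
(`ABC` gives every `η < ε`, p143568). -/
theorem movingRoth4_budget_lt_two {ε η : ℝ} (hε : ε ≤ 2) (hη : 2 ≤ η) :
    ¬ ∃ Z₀ : ℕ, ∀ v w Y Z : ℕ, Z₀ ≤ Z → 0 < v → 0 < w → 0 < Y → Nat.Coprime (v * Y) (w * Z) →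
      ((max v w : ℕ) : ℝ) ≤ (Z : ℝ) ^ η → w * Z ^ 4 ≠ v * Y ^ 4 →
      (Z : ℝ) ^ (2 - ε) < |((w * Z ^ 4 : ℕ) : ℝ) - ((v * Y ^ 4 : ℕ) : ℝ)| :=
  not_ubq₂_of_two_le η (2 - ε) hη (by linarith)

/-- **The unit slice at its pin**: the ON-piece `UBQOn unitSlice η` of the strategist's split Dc1 (the core restricted to
`wZ⁴ − vY⁴ ∣ 4`, matrix verbatim) is FALSE for every `η ≥ 2` (`not_ubqOn_unitSlice_of_two_lt`, p138228, had `η > 2`). -/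
theorem not_ubqOn_unitSlice_of_two_le (η : ℝ) (hη : 2 ≤ η) :
    ¬ ∃ Z₀ : ℕ, ∀ v w Y Z : ℕ, Z₀ ≤ Z → ((w * Z ^ 4 : ℤ) - (v * Y ^ 4 : ℤ)) ∣ 4 → 0 < v → 0 < w → 0 < Y →
      Nat.Coprime (v * Y) (w * Z) → ((max v w : ℕ) : ℝ) ≤ (Z : ℝ) ^ η → w * Z ^ 4 ≠ v * Y ^ 4 →
      (Z : ℝ) ^ η < |((w * Z ^ 4 : ℕ) : ℝ) - ((v * Y ^ 4 : ℕ) : ℝ)| := by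
  rintro ⟨Z₀, h⟩
  obtain ⟨v, w, Y, Z, hNZ, hv, hw, hY, hZ1, hcop, hid, hwv, hvZ, -⟩ := exists_pell3Bezout Z₀
  have hZR : (1 : ℝ) ≤ Z := by exact_mod_cast hZ1
  have hmax : ((max v w : ℕ) : ℝ) ≤ (Z : ℝ) ^ η := by
    rw [max_eq_left hwv]
    have h1 : (v : ℝ) ≤ (Z : ℝ) ^ (2 : ℕ) := by
      have : ((v : ℕ) : ℝ) ≤ ((Z ^ 2 : ℕ) : ℝ) := by exact_mod_cast (Nat.le_of_succ_le hvZ)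
      push_cast at this; exact this
    have h2 : (Z : ℝ) ^ (2 : ℕ) ≤ (Z : ℝ) ^ η := by
      rw [← Real.rpow_natCast]
      exact Real.rpow_le_rpow_of_exponent_le hZR (by exact_mod_cast hη)
    exact h1.trans h2
  have hne : w * Z ^ 4 ≠ v * Y ^ 4 := by rw [hid]; omega
  have hdvd : ((w * Z ^ 4 : ℤ) - (v * Y ^ 4 : ℤ)) ∣ 4 := by
    have : ((w * Z ^ 4 : ℕ) : ℤ) = ((v * Y ^ 4 + 1 : ℕ) : ℤ) := by exact_mod_cast hid
    push_cast at this
    refine ⟨4, ?_⟩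
    rw [this]; ring
  have key := h v w Y Z hNZ hdvd hv hw hY hcop hmax hne
  have habs : |((w * Z ^ 4 : ℕ) : ℝ) - ((v * Y ^ 4 : ℕ) : ℝ)| = 1 := by
    rw [hid]; push_cast
    rw [show (((v : ℝ) * (Y : ℝ) ^ 4 + 1) - (v : ℝ) * (Y : ℝ) ^ 4) = 1 by ring]
    norm_num
  rw [habs] at key
  have : (1 : ℝ) ≤ (Z : ℝ) ^ η := Real.one_le_rpow hZR (by linarith)
  linarith

end Summit.ABC.ABC.Theorems.TowerFourSubLiouville.Negative
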